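import Mathlib
import HarnessLib

/-!
# Convex functions: closure properties, the gradient inequality, and minimization over a convex
# set (Luenberger–Ye, §6.4–§6.5)

[LY08] = D. G. Luenberger, Y. Ye, *Linear and Nonlinear Programming* [LuenbergerYe2008], chapter
"Basic Properties of Solutions and Algorithms", §6.4 "Convex and concave functions" and §6.5
"Minimization and maximization of convex functions" in the held copy
`book:luenberger2008-linear-nonlinear-programming` (§7.4–§7.5 of the Springer 2008 printing).

§6.4: **Proposition 1** (`f₁ + f₂` is convex), **Proposition 2** (`a f` is convex for `a ≥ 0`),
**Proposition 3** (the sublevel sets `Γ_c = {x ∈ Ω : f(x) ≤ c}` are convex), **Proposition 4**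
(`f ∈ C¹` is convex over the convex set `Ω` iff `f(y) ≥ f(x) + ∇f(x)(y − x)` for all `x, y ∈ Ω`
(9) — "linear approximation based on the local derivative underestimates the function"; proof:
"only if" by letting `α → 0` in the difference quotient along the segment, "if" by adding
`α`·(10) and `(1 − α)`·(11)). §6.5: **Theorem 1** (for `f` convex on convex `Ω` the set `Γ` where
`f` achieves its minimum is convex, and any relative minimum is a global minimum), **Theorem 2**
(`f ∈ C¹` convex on convex `Ω`: if `∇f(x*)(y − x*) ≥ 0` for all `y ∈ Ω` then `x*` is a global
minimum point; "the given condition is equivalent to the first-order necessary condition stated in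
Section 6.1", `y − x*` being a feasible direction).

Formalised here over a real normed space `E`, with the derivative as a continuous linear
functional `f' x : E →L[ℝ] ℝ` (`∇f(x)(y − x)` is `f' x (y − x)`): Propositions 1–3 (from Mathlib's
`ConvexOn.add`, `ConvexOn.smul`, `ConvexOn.convex_le`); Proposition 4 in both directions — the
"if" direction is proved for an ARBITRARY field of linear functionals `f'` (no differentiability is
used: any function admitting affine minorants touching it everywhere on `Ω` is convex), the "only
if" direction for `f` Fréchet differentiable at the points of `Ω` — and as the stated equivalence
(`convexOn_of_gradient_inequality`, `gradient_inequality_of_convexOn`,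
`convexOn_iff_gradient_inequality`); Theorem 1 (`convex_setOf_isMinOn`, `isMinOn_of_isLocalMinOn`,
the latter being Mathlib's `IsMinOn.of_isLocalMinOn_of_convexOn`); Theorem 2 together with its
converse, the first-order necessary condition over a convex set (`isMinOn_of_fderiv_nonneg`,
`fderiv_nonneg_of_isMinOn`, `isMinOn_iff_fderiv_nonneg`). Not formalised: Proposition 5 (`C²`:
convex iff the Hessian is positive semidefinite; Mathlib's `convexOn_of_deriv2_nonneg` is the
one-variable "if" direction) and Theorem 3 of §6.5 (maximum at an extreme point; see the tree's
`QuasiconvexMaximumPrinciple.lean`). Relation to the tree: the "only if" direction of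
Proposition 4 is also `Literature.Analysis.Convex.Subgradient.ConvexOn.apply_add_fderiv_le`
(Hiriart-Urruty–Lemaréchal), not imported here (tree-snapshot build rule) and re-derived as a
private step; the tree's `AveragedOperators.isMinOn_iff_inner_nonneg` (Carlier, Lemma 6.2) is
Theorem 2 with its converse in a Hilbert space, phrased with the gradient and the inner product —
here the normed-space version with the Fréchet derivative as a functional, proved from
Proposition 4 directly; `FeasibleDirectionConditions.lean` has the §6.1 necessary condition for
feasible directions in `ℝⁿ`.

Published results only (Lean placement rule): every public declaration carries its
`[cite: LuenbergerYe2008, §6.4/§6.5 …]` locator.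
-/

namespace Literature.Analysis.Convex.ConvexGradientInequality

open Set Filter Topology

variable {E : Type*} [NormedAddCommGroup E] [NormedSpace ℝ E]
variable {Ω : Set E} {f f₁ f₂ : E → ℝ}

/-! ## §6.4 Propositions 1–3: combinations and sublevel sets -/

/-- **Proposition 1.** The sum of two convex functions on the convex set `Ω` is convex.
[cite: LuenbergerYe2008, §6.4 Proposition 1] -/
theorem convexOn_add (h₁ : ConvexOn ℝ Ω f₁) (h₂ : ConvexOn ℝ Ω f₂) : ConvexOn ℝ Ω (f₁ + f₂) :=
  h₁.add h₂

/-- **Proposition 2.** A nonnegative multiple `a f`, `a ≥ 0`, of a convex function is convex.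
[cite: LuenbergerYe2008, §6.4 Proposition 2] -/
theorem convexOn_smul (hf : ConvexOn ℝ Ω f) {a : ℝ} (ha : 0 ≤ a) : ConvexOn ℝ Ω (fun x => a * f x) :=
  hf.smul ha

/-- Hence positive combinations `a₁ f₁ + a₂ f₂` of convex functions are convex ("through repeated
application of the above two propositions"). [cite: LuenbergerYe2008, §6.4 (after Proposition 2:
"a positive combination of convex functions is again convex")] -/
theorem convexOn_combination (h₁ : ConvexOn ℝ Ω f₁) (h₂ : ConvexOn ℝ Ω f₂) {a₁ a₂ : ℝ}
    (ha₁ : 0 ≤ a₁) (ha₂ : 0 ≤ a₂) : ConvexOn ℝ Ω (fun x => a₁ * f₁ x + a₂ * f₂ x) :=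
  (h₁.smul ha₁).add (h₂.smul ha₂)

/-- **Proposition 3.** The sublevel set `Γ_c = {x ∈ Ω : f x ≤ c}` of a convex function on a convex
set is convex for every real `c`. [cite: LuenbergerYe2008, §6.4 Proposition 3] -/
theorem convex_sublevelSet (hf : ConvexOn ℝ Ω f) (c : ℝ) : Convex ℝ {x ∈ Ω | f x ≤ c} :=
  hf.convex_le c

/-! ## §6.4 Proposition 4: the gradient inequality -/

/-- **Proposition 4, "if".** If `f(y) ≥ f(x) + f'(x)(y − x)` for all `x, y ∈ Ω` (9), for some
assignment `x ↦ f'(x)` of continuous linear functionals, then `f` is convex on the convex set `Ω`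
(the text takes `f' = ∇f`; the argument — add `α`·(10) and `(1 − α)`·(11) at
`x = α x₁ + (1 − α) x₂` — uses only the linearity of `f'(x)`). [cite: LuenbergerYe2008, §6.4
Proposition 4 (proof, "if" part, (10)–(11))] -/
theorem convexOn_of_gradient_inequality (hΩ : Convex ℝ Ω) (f' : E → E →L[ℝ] ℝ)
    (h : ∀ x ∈ Ω, ∀ y ∈ Ω, f x + f' x (y - x) ≤ f y) : ConvexOn ℝ Ω f := by
  refine ⟨hΩ, fun x₁ hx₁ x₂ hx₂ a b ha hb hab => ?_⟩
  set x := a • x₁ + b • x₂ with hx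
  have hxΩ : x ∈ Ω := hΩ hx₁ hx₂ ha hb hab
  have h₁ := h x hxΩ x₁ hx₁
  have h₂ := h x hxΩ x₂ hx₂
  -- `a (x₁ - x) + b (x₂ - x) = 0`
  have hcomb : a • (x₁ - x) + b • (x₂ - x) = 0 := by
    rw [hx, smul_sub, smul_sub, smul_add, smul_add, ← mul_smul, ← mul_smul, ← mul_smul, ← mul_smul]
    have hb' : b = 1 - a := by linarith
    subst hb'
    module
  have hlin : a * f' x (x₁ - x) + b * f' x (x₂ - x) = 0 := by
    have := congrArg (f' x) hcomb
    simpa [map_add, map_smul, smul_eq_mul] using this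
  have ha₁ := mul_le_mul_of_nonneg_left h₁ ha
  have hb₂ := mul_le_mul_of_nonneg_left h₂ hb
  have : (a + b) * f x ≤ a * f x₁ + b * f x₂ := by nlinarith
  rw [hab, one_mul] at this
  simpa [smul_eq_mul] using this

/-- The difference quotient of a convex function along a segment is bounded by the chord slope:
`(f(x + t(y − x)) − f(x))/t ≤ f(y) − f(x)` for `0 < t ≤ 1`. [folklore] -/
private theorem slope_le_of_convexOn (hf : ConvexOn ℝ Ω f) {x y : E} (hx : x ∈ Ω) (hy : y ∈ Ω)
    {t : ℝ} (ht0 : 0 < t) (ht1 : t ≤ 1) :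
    t⁻¹ * (f (x + t • (y - x)) - f x) ≤ f y - f x := by
  have hconv := hf.2 hx hy (by linarith : 0 ≤ 1 - t) ht0.le (by ring)
  have hpt : (1 - t) • x + t • y = x + t • (y - x) := by
    simp only [sub_smul, one_smul, smul_sub]; abel
  rw [hpt, smul_eq_mul, smul_eq_mul] at hconv
  rw [inv_mul_le_iff₀ ht0]
  nlinarith

/-- **Proposition 4, "only if".** A convex function that is (Fréchet) differentiable at `x ∈ Ω`
satisfies `f(y) ≥ f(x) + f'(x)(y − x)` for every `y ∈ Ω` (let `α → 0⁺` in the difference quotient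
along the segment).  In the Hilbert-space setting (`InnerProductSpace ℝ E`) the tree's
`Subgradient.ConvexOn.apply_add_fderiv_le` is the same inequality; here `E` is any real normed
space. [cite: LuenbergerYe2008, §6.4 Proposition 4 (proof, "only if" part)] -/
theorem gradient_inequality_of_convexOn (hf : ConvexOn ℝ Ω f) {x y : E} (hx : x ∈ Ω) (hy : y ∈ Ω)
    {f'x : E →L[ℝ] ℝ} (hd : HasFDerivAt f f'x x) : f x + f'x (y - x) ≤ f y := by
  -- the restriction `g t = f (x + t (y - x))` has derivative `f'x (y - x)` at `t = 0`
  set g : ℝ → ℝ := fun t => f (x + t • (y - x)) with hg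
  have hline : HasDerivAt (fun t : ℝ => x + t • (y - x)) (y - x) 0 := by
    simpa using ((hasDerivAt_id (0 : ℝ)).smul_const (y - x)).const_add x
  have hd0 : HasFDerivAt f f'x (x + (0 : ℝ) • (y - x)) := by simpa using hd
  have hgd : HasDerivAt g (f'x (y - x)) 0 := hd0.comp_hasDerivAt (0 : ℝ) hline
  have htend : Tendsto (fun t => t⁻¹ • (g (0 + t) - g 0)) (𝓝[>] 0) (𝓝 (f'x (y - x))) :=
    hgd.tendsto_slope_zero_right
  have hmem : Ioo (0 : ℝ) 1 ∈ 𝓝[>] (0 : ℝ) := Ioo_mem_nhdsGT zero_lt_one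
  have hle : f'x (y - x) ≤ f y - f x := by
    refine le_of_tendsto htend ?_
    filter_upwards [hmem] with t ht
    have := slope_le_of_convexOn hf hx hy ht.1 ht.2.le
    simpa [hg, smul_eq_mul] using this
  linarith

/-- **Proposition 4** as stated: a function differentiable at the points of the convex set `Ω`
(`f' x` its derivative at `x`) is convex on `Ω` iff `f(y) ≥ f(x) + f'(x)(y − x)` for all
`x, y ∈ Ω` (9). [cite: LuenbergerYe2008, §6.4 Proposition 4 ((9), Fig. 6.4)] -/
theorem convexOn_iff_gradient_inequality (hΩ : Convex ℝ Ω) {f' : E → E →L[ℝ] ℝ}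
    (hd : ∀ x ∈ Ω, HasFDerivAt f (f' x) x) :
    ConvexOn ℝ Ω f ↔ ∀ x ∈ Ω, ∀ y ∈ Ω, f x + f' x (y - x) ≤ f y :=
  ⟨fun hf x hx _ hy => gradient_inequality_of_convexOn hf hx hy (hd x hx),
    convexOn_of_gradient_inequality hΩ f'⟩

/-! ## §6.5 Theorems 1–2: minimization of convex functions -/

/-- **Theorem 1, first part.** For `f` convex on the convex set `Ω`, the set `Γ` of points where
`f` achieves its minimum over `Ω` is convex (it is a sublevel set, Proposition 3).
[cite: LuenbergerYe2008, §6.5 Theorem 1] -/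
theorem convex_setOf_isMinOn (hf : ConvexOn ℝ Ω f) : Convex ℝ {x ∈ Ω | IsMinOn f Ω x} := by
  by_cases hne : ∃ x₀ ∈ Ω, IsMinOn f Ω x₀
  · obtain ⟨x₀, hx₀, hmin⟩ := hne
    have hEq : {x ∈ Ω | IsMinOn f Ω x} = {x ∈ Ω | f x ≤ f x₀} := by
      ext x
      simp only [mem_setOf_eq, and_congr_right_iff]
      intro hx
      exact ⟨fun h => h hx₀, fun h z hz => h.trans (hmin hz)⟩
    rw [hEq]
    exact hf.convex_le _
  · push Not at hne
    have hEq : {x ∈ Ω | IsMinOn f Ω x} = ∅ :=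
      eq_empty_of_forall_notMem fun x hx => hne x hx.1 hx.2
    rw [hEq]
    exact convex_empty

/-- **Theorem 1, second part.** Any relative minimum of a convex function over a convex set is a
global minimum (Mathlib's `IsMinOn.of_isLocalMinOn_of_convexOn`). [cite: LuenbergerYe2008, §6.5
Theorem 1] -/
theorem isMinOn_of_isLocalMinOn (hf : ConvexOn ℝ Ω f) {x : E} (hx : x ∈ Ω)
    (hloc : IsLocalMinOn f Ω x) : IsMinOn f Ω x :=
  IsMinOn.of_isLocalMinOn_of_convexOn hx hloc hf

/-- **Theorem 2.** Let `f` be convex on the convex set `Ω` and differentiable at `x* ∈ Ω` with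
derivative `f'`. If `f'(y − x*) ≥ 0` for all `y ∈ Ω`, then `x*` is a global minimum point of `f`
over `Ω` (immediate from Proposition 4). [cite: LuenbergerYe2008, §6.5 Theorem 2] -/
theorem isMinOn_of_fderiv_nonneg (hf : ConvexOn ℝ Ω f) {xs : E} (hxs : xs ∈ Ω)
    {f' : E →L[ℝ] ℝ} (hd : HasFDerivAt f f' xs) (h : ∀ y ∈ Ω, 0 ≤ f' (y - xs)) :
    IsMinOn f Ω xs := by
  intro y hy
  have := gradient_inequality_of_convexOn hf hxs hy hd
  have h0 := h y hy
  simp only [mem_setOf_eq]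
  linarith

/-- The converse of Theorem 2 — the first-order necessary condition of §6.1 read on a convex set
(`y − x*` is a feasible direction): if `x* ∈ Ω` minimises `f` over the convex set `Ω` and `f` is
differentiable at `x*`, then `f'(y − x*) ≥ 0` for every `y ∈ Ω` (no convexity of `f` needed).
[cite: LuenbergerYe2008, §6.5 Theorem 2 (proof: "the given condition is equivalent to the
first-order necessary condition stated in Section 6.1")] -/
theorem fderiv_nonneg_of_isMinOn (hΩ : Convex ℝ Ω) {xs : E} (hxs : xs ∈ Ω) (hmin : IsMinOn f Ω xs)
    {f' : E →L[ℝ] ℝ} (hd : HasFDerivAt f f' xs) {y : E} (hy : y ∈ Ω) : 0 ≤ f' (y - xs) := by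
  set g : ℝ → ℝ := fun t => f (xs + t • (y - xs)) with hg
  have hline : HasDerivAt (fun t : ℝ => xs + t • (y - xs)) (y - xs) 0 := by
    simpa using ((hasDerivAt_id (0 : ℝ)).smul_const (y - xs)).const_add xs
  have hd0 : HasFDerivAt f f' (xs + (0 : ℝ) • (y - xs)) := by simpa using hd
  have hgd : HasDerivAt g (f' (y - xs)) 0 := hd0.comp_hasDerivAt (0 : ℝ) hline
  have htend : Tendsto (fun t => t⁻¹ • (g (0 + t) - g 0)) (𝓝[>] 0) (𝓝 (f' (y - xs))) :=
    hgd.tendsto_slope_zero_right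
  have hmem : Ioo (0 : ℝ) 1 ∈ 𝓝[>] (0 : ℝ) := Ioo_mem_nhdsGT zero_lt_one
  refine ge_of_tendsto htend ?_
  filter_upwards [hmem] with t ht
  -- the point `xs + t (y - xs) = (1 - t) xs + t y` lies in `Ω`, so `g t ≥ g 0`
  have hpt : xs + t • (y - xs) ∈ Ω := by
    have := hΩ hxs hy (by linarith [ht.2] : 0 ≤ 1 - t) ht.1.le (by ring)
    have hid : (1 - t) • xs + t • y = xs + t • (y - xs) := by
      simp only [sub_smul, one_smul, smul_sub]; abel
    simpa [hid] using this
  have hge : g 0 ≤ g t := by simpa [hg] using hmin hpt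
  have : 0 ≤ t⁻¹ * (g (0 + t) - g 0) := by
    rw [zero_add]; exact mul_nonneg (inv_nonneg.2 ht.1.le) (sub_nonneg.2 hge)
  simpa [smul_eq_mul] using this

/-- For a convex function differentiable at `x* ∈ Ω` (convex), `x*` minimises `f` over `Ω` iff
`f'(y − x*) ≥ 0` for all `y ∈ Ω`. [cite: LuenbergerYe2008, §6.5 Theorem 2 (with the first-order
necessary condition of §6.1)] -/
theorem isMinOn_iff_fderiv_nonneg (hf : ConvexOn ℝ Ω f) {xs : E} (hxs : xs ∈ Ω)
    {f' : E →L[ℝ] ℝ} (hd : HasFDerivAt f f' xs) :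
    IsMinOn f Ω xs ↔ ∀ y ∈ Ω, 0 ≤ f' (y - xs) :=
  ⟨fun hmin _ hy => fderiv_nonneg_of_isMinOn hf.1 hxs hmin hd hy,
    isMinOn_of_fderiv_nonneg hf hxs hd⟩

end Literature.Analysis.Convex.ConvexGradientInequality
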